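import Summits.NavierStokesRegularity.NavierStokesRegularity.Theorems.QuantisedSymmetryPolyhedralDssProfileExistsStubWitnessPortrait
import Summits.NavierStokesRegularity.NavierStokesRegularity.Theorems.QuantisedSymmetryPolyhedralDssProfileExistsStubIsotropicMoments
import Summits.NavierStokesRegularity.NavierStokesRegularity.Theorems.QuantisedSymmetryPolyhedralDssProfileExistsStubGaussianEnstrophyIdentity
import Summits.NavierStokesRegularity.NavierStokesRegularity.Theorems.QuantisedSymmetryPolyhedralDssProfileExistsStubOrbitBounds
import Summits.NavierStokesRegularity.NavierStokesRegularity.Theorems.QuantisedSymmetryPolyhedralDssProfileExistsStubEnstrophyFloor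
import Summits.NavierStokesRegularity.NavierStokesRegularity.Theorems.QuantisedSymmetryPolyhedralDssProfileExistsStubHeadPressurePumping
import HarnessLib

/-!
# The portrait of a witness, II — crux stmt-NavierStokesRegularity-1404 (`QuantisedSymmetry.PolyhedralDssProfileExists`),
  line polyhedral_cell (lead c16)

Second assembly file, registered stub N15: for an arbitrary witness `(G, c, u, C₀)` of the crux X⁻, its Oseen-gauge
representative `V` (A1 p156260, A2 p155960, classical pressure p152134) has slices with isotropic Gaussian-weighted
Reynolds stresses (N6, p159902), and its Leray orbit `U = lerayOrbit V` with the normalised pressure of N12 (p162679) is a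
`2 log c`-periodic classical solution of the backward Leray system obeying the profile bound, the Gaussian enstrophy
identity (N10, p162020), the strict inward-pumping sign (N14, p162892) and the local-enstrophy floor (N13, p162579).
No new analysis: bookkeeping over landed theorems.
-/

noncomputable section

-- the summit namespace `…NavierStokesRegularity.NavierStokesRegularity…` is the tree convention (D-0017)
set_option linter.dupNamespace false

namespace Summit.NavierStokesRegularity.NavierStokesRegularity.Theorems.PolyhedralDssProfileExists.PolyhedralCell

open MeasureTheory Set Function Filter Topology
open Literature.Analysis Literature.Analysis.FluidPDE
open scoped InnerProductSpace RealInnerProductSpace Laplacian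

/-- **Gaussian-weighted squares of a bounded continuous field are integrable**: if `w` is continuous with
`‖w x‖ ≤ M`, then `x ↦ e^{−‖x‖²} ‖w x‖²` is integrable on `ℝ³`. [folklore] -/
theorem portraitII_integrable_gauss_mul_norm_sq
    {w : EuclideanSpace ℝ (Fin 3) → EuclideanSpace ℝ (Fin 3)} (hw : Continuous w) {M : ℝ}
    (hM : ∀ x, ‖w x‖ ≤ M) :
    Integrable (fun x => Real.exp (-‖x‖ ^ 2) * ‖w x‖ ^ 2) volume := by
  have hg : Integrable (fun x : EuclideanSpace ℝ (Fin 3) => Real.exp (-1 * ‖x‖ ^ 2)) volume :=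
    PineauVicol2026.integrable_exp_neg_mul_sq_norm' one_pos
  have hg' : Integrable (fun x : EuclideanSpace ℝ (Fin 3) => M ^ 2 * Real.exp (-1 * ‖x‖ ^ 2)) volume :=
    hg.const_mul _
  refine hg'.mono' ((Real.continuous_exp.comp (continuous_norm.pow 2).neg).mul (hw.norm.pow 2)).aestronglyMeasurable
    (Eventually.of_forall fun x => ?_)
  have h0 : 0 ≤ Real.exp (-‖x‖ ^ 2) := (Real.exp_pos _).le
  have h1 : ‖w x‖ ^ 2 ≤ M ^ 2 := by
    have := hM x
    have hMn : 0 ≤ M := (norm_nonneg _).trans this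
    nlinarith [norm_nonneg (w x)]
  rw [Real.norm_of_nonneg (mul_nonneg h0 (sq_nonneg _)), neg_one_mul]
  calc Real.exp (-‖x‖ ^ 2) * ‖w x‖ ^ 2 ≤ Real.exp (-‖x‖ ^ 2) * M ^ 2 :=
        mul_le_mul_of_nonneg_left h1 h0
    _ = M ^ 2 * Real.exp (-‖x‖ ^ 2) := by ring

/-- **Isotropy of the Gaussian-weighted Reynolds stress of an equivariant slice (instance of N6).** If `G` acts
irreducibly on `ℝ³` and the continuous bounded field `w` is `G`-equivariant, then for all `a, b`:
`∫ e^{−‖x‖²}⟪a, w x⟫⟪b, w x⟫ dx = (⟪a,b⟫/3) ∫ e^{−‖x‖²}‖w x‖² dx`. [cite: SerreLinearRepresentations1977, §13.2] -/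
theorem portraitII_isotropy_gauss
    {G : Subgroup (EuclideanSpace ℝ (Fin 3) ≃ₗᵢ[ℝ] EuclideanSpace ℝ (Fin 3))}
    (hirr : ∀ W : Submodule ℝ (EuclideanSpace ℝ (Fin 3)), (∀ g ∈ G, ∀ v ∈ W, g v ∈ W) → W = ⊥ ∨ W = ⊤)
    {w : EuclideanSpace ℝ (Fin 3) → EuclideanSpace ℝ (Fin 3)} (hw : Continuous w) {M : ℝ} (hM : ∀ x, ‖w x‖ ≤ M)
    (hequ : ∀ g ∈ G, ∀ x, w (g x) = g (w x)) (a b : EuclideanSpace ℝ (Fin 3)) :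
    ∫ x, Real.exp (-‖x‖ ^ 2) * (⟪a, w x⟫_ℝ * ⟪b, w x⟫_ℝ) =
      ⟪a, b⟫_ℝ / 3 * ∫ x, Real.exp (-‖x‖ ^ 2) * ‖w x‖ ^ 2 := by
  have h := stub_isotropicMoments G hirr w (fun r => Real.exp (-r ^ 2)) hw
    (Real.continuous_exp.comp (continuous_pow 2).neg) hequ
    (by simpa using portraitII_integrable_gauss_mul_norm_sq hw hM) a b
  simpa using h

/-- **Repackaging the decay bounds of N12 as the polynomial bounds of N10/N14** (exponent `4`, constant
`max K C₀`). [folklore] -/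
theorem portraitII_poly_bounds {U : ℝ → EuclideanSpace ℝ (Fin 3) → EuclideanSpace ℝ (Fin 3)}
    {P : ℝ → EuclideanSpace ℝ (Fin 3) → ℝ} {K C₀ : ℝ} (hK0 : 0 ≤ K)
    (hprof : ∀ s y, (1 + ‖y‖) * ‖U s y‖ ≤ C₀)
    (hbds : ∀ s y, (1 + ‖y‖) * ‖U s y‖ ≤ C₀ ∧
      ‖fderiv ℝ (U s) y‖ ≤ K * ((max ‖y‖ 1)⁻¹) ^ 2 ∧
      ‖iteratedFDeriv ℝ 2 (U s) y‖ ≤ K * ((max ‖y‖ 1)⁻¹) ^ 3 ∧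
      ‖gradient (P s) y‖ ≤ K * (1 + ‖y‖) ^ 3 ∧ |P s y| ≤ K * (1 + ‖y‖) ^ 4 ∧
      ‖timeDeriv U s y‖ ≤ K * (1 + ‖y‖) ^ 3) :
    ∃ K' : ℝ, ∃ N : ℕ, ∀ s y,
      ‖U s y‖ ≤ K' * (1 + ‖y‖) ^ N ∧ ‖fderiv ℝ (U s) y‖ ≤ K' * (1 + ‖y‖) ^ N ∧
      ‖timeDeriv U s y‖ ≤ K' * (1 + ‖y‖) ^ N ∧ |P s y| ≤ K' * (1 + ‖y‖) ^ N ∧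
      ‖gradient (P s) y‖ ≤ K' * (1 + ‖y‖) ^ N := by
  refine ⟨max K C₀, 4, fun s y => ?_⟩
  obtain ⟨-, h2, -, h4, h5, h6⟩ := hbds s y
  have hy : 1 ≤ 1 + ‖y‖ := by have := norm_nonneg y; linarith
  have hy0 : 0 ≤ 1 + ‖y‖ := by positivity
  have hy4 : 1 ≤ (1 + ‖y‖) ^ 4 := one_le_pow₀ hy
  have h34 : (1 + ‖y‖) ^ 3 ≤ (1 + ‖y‖) ^ 4 := pow_le_pow_right₀ hy (by norm_num)
  have hKle : K ≤ max K C₀ := le_max_left _ _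
  have hC₀le : C₀ ≤ max K C₀ := le_max_right _ _
  have hM0 : 0 ≤ max K C₀ := hK0.trans hKle
  have hMy : max K C₀ ≤ max K C₀ * (1 + ‖y‖) ^ 4 := le_mul_of_one_le_right hM0 hy4
  -- `(max ‖y‖ 1)⁻¹ ≤ 1`
  have hinv : (max ‖y‖ 1)⁻¹ ≤ 1 := inv_le_one_of_one_le₀ (le_max_right _ _)
  have hinv0 : 0 ≤ (max ‖y‖ 1)⁻¹ := inv_nonneg.2 (le_trans zero_le_one (le_max_right _ _))
  have hinv2 : ((max ‖y‖ 1)⁻¹) ^ 2 ≤ 1 := pow_le_one₀ hinv0 hinv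
  refine ⟨?_, ?_, ?_, ?_, ?_⟩
  · -- `‖U‖ ≤ C₀`
    have hU1 : ‖U s y‖ ≤ C₀ :=
      le_trans (le_mul_of_one_le_left (norm_nonneg _) hy) (hprof s y)
    exact hU1.trans (hC₀le.trans hMy)
  · calc ‖fderiv ℝ (U s) y‖ ≤ K * ((max ‖y‖ 1)⁻¹) ^ 2 := h2
      _ ≤ K * 1 := mul_le_mul_of_nonneg_left hinv2 hK0
      _ ≤ max K C₀ * (1 + ‖y‖) ^ 4 := by rw [mul_one]; exact hKle.trans hMy
  · calc ‖timeDeriv U s y‖ ≤ K * (1 + ‖y‖) ^ 3 := h6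
      _ ≤ max K C₀ * (1 + ‖y‖) ^ 4 := mul_le_mul hKle h34 (by positivity) hM0
  · calc |P s y| ≤ K * (1 + ‖y‖) ^ 4 := h5
      _ ≤ max K C₀ * (1 + ‖y‖) ^ 4 := mul_le_mul_of_nonneg_right hKle (by positivity)
  · calc ‖gradient (P s) y‖ ≤ K * (1 + ‖y‖) ^ 3 := h4
      _ ≤ max K C₀ * (1 + ‖y‖) ^ 4 := mul_le_mul hKle h34 (by positivity) hM0

/-- **REGISTERED STUB `stub_witnessPortraitII` (N15, lead c16): the portrait of a witness, II — its Leray orbit.**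
See the module docstring. Assembly of A1, A2, p152134, N6, N10, N12, N13, N14. [folklore] -/
theorem stub_witnessPortraitII :
    ∃ δ₀ : ℝ, 0 < δ₀ ∧ ∀ C₀ : ℝ, ∃ R : ℝ, 0 < R ∧
      ∀ (G : Subgroup (EuclideanSpace ℝ (Fin 3) ≃ₗᵢ[ℝ] EuclideanSpace ℝ (Fin 3))) (c : ℝ)
        (u : ℝ → EuclideanSpace ℝ (Fin 3) → EuclideanSpace ℝ (Fin 3)),
        (∀ W : Submodule ℝ (EuclideanSpace ℝ (Fin 3)), (∀ g ∈ G, ∀ v ∈ W, g v ∈ W) → W = ⊥ ∨ W = ⊤) →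
        1 < c → IsAncientMildSolution 1 u → (∀ t < 0, AEStronglyMeasurable (u t) volume) →
        IsDiscretelySelfSimilar c u → HasTypeIDecay C₀ u → (∀ g ∈ G, ∀ t x, u t (g x) = g (u t x)) →
        ¬ (∀ t < 0, u t =ᵐ[volume] 0) →
        ∃ (V : ℝ → EuclideanSpace ℝ (Fin 3) → EuclideanSpace ℝ (Fin 3)) (C : ℝ)
          (p : ℝ → EuclideanSpace ℝ (Fin 3) → ℝ) (P : ℝ → EuclideanSpace ℝ (Fin 3) → ℝ),
          IsTypeIAncientMild C V ∧ HasTypeIDecay C₀ V ∧ (∀ t < 0, V t =ᵐ[volume] u t) ∧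
          IsDiscretelySelfSimilar c V ∧ (∀ g ∈ G, ∀ t x, V t (g x) = g (V t x)) ∧
          IsClassicalNSSolutionOn (Set.Iio 0) 1 0 V p ∧
          (∀ t < 0, ∀ a b : EuclideanSpace ℝ (Fin 3),
            ∫ x, Real.exp (-‖x‖ ^ 2) * (⟪a, V t x⟫_ℝ * ⟪b, V t x⟫_ℝ) =
              ⟪a, b⟫_ℝ / 3 * ∫ x, Real.exp (-‖x‖ ^ 2) * ‖V t x‖ ^ 2) ∧
          IsBackwardLeraySolutionOn Set.univ 1 (lerayOrbit V) P ∧ (∀ s, P s 0 = 0) ∧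
          Function.Periodic (lerayOrbit V) (2 * Real.log c) ∧
          (∀ s y, (1 + ‖y‖) * ‖lerayOrbit V s y‖ ≤ C₀) ∧
          (∫ s in (0 : ℝ)..(2 * Real.log c), ∫ y, Real.exp (-‖y‖ ^ 2 / 4) * ‖curl (lerayOrbit V s) y‖ ^ 2 =
            -(1 / 2 : ℝ) * ∫ s in (0 : ℝ)..(2 * Real.log c), ∫ y, Real.exp (-‖y‖ ^ 2 / 4) *
              ((P s y + ‖lerayOrbit V s y‖ ^ 2 / 2 + ⟪y, lerayOrbit V s y⟫_ℝ / 2) * ⟪y, lerayOrbit V s y⟫_ℝ)) ∧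
          (∫ s in (0 : ℝ)..(2 * Real.log c), ∫ y, Real.exp (-‖y‖ ^ 2 / 4) *
              ((P s y + ‖lerayOrbit V s y‖ ^ 2 / 2 + ⟪y, lerayOrbit V s y⟫_ℝ / 2) * ⟪y, lerayOrbit V s y⟫_ℝ) < 0) ∧
          (∃ s ∈ Set.Icc (0 : ℝ) (2 * Real.log c),
            δ₀ < Real.sqrt (∫ y in Metric.ball (0 : EuclideanSpace ℝ (Fin 3)) R, ‖curl (lerayOrbit V s) y‖ ^ 2)) := by
  obtain ⟨δ₀, hδ₀, hN13⟩ := stub_enstrophyFloor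
  refine ⟨δ₀, hδ₀, fun C₀ => ?_⟩
  obtain ⟨R, hR, hfloor⟩ := hN13 C₀
  obtain ⟨K, hK0, hN12⟩ := stub_orbitBounds C₀
  refine ⟨R, hR, ?_⟩
  intro G c u hirr hc hanc hmeas hdss hdec hequ hnt
  -- A1, A2, classical pressure, a nonzero point
  obtain ⟨V, C, hV, hdecV, hae, hzero⟩ := stub_smoothRepresentative_ae u C₀ hanc hmeas hdec
  obtain ⟨hdssV, hequV⟩ := stub_transport_ae G c u V C hc hdss hequ hV hae hzero
  obtain ⟨p, hcl⟩ := exists_isClassicalNSSolutionOn_Iio_of_isTypeIAncientMild hV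
  obtain ⟨t₀, ht₀, x₀, hx₀⟩ := exists_apply_ne_zero_of_ae_repr hae hnt
  -- N12: the orbit and its normalised pressure
  obtain ⟨P, hBL, hP0, hbds⟩ := hN12 V p hcl hdecV
  have hc0 : 0 < c := lt_trans one_pos hc
  have hS : 0 < 2 * Real.log c := mul_pos two_pos (Real.log_pos hc)
  have hper : Function.Periodic (lerayOrbit V) (2 * Real.log c) := hdssV.periodic_lerayOrbit hc0
  have hprof : ∀ s y, (1 + ‖y‖) * ‖lerayOrbit V s y‖ ≤ C₀ := hasTypeIDecay_iff_lerayOrbit.1 hdecV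
  have hpoly := portraitII_poly_bounds (U := lerayOrbit V) (P := P) hK0 hprof hbds
  -- N10, N14
  have hN10 := stub_gaussianEnstrophyIdentity (lerayOrbit V) P (2 * Real.log c) hS hBL hper hpoly
  have hUne : ∃ s y, lerayOrbit V s y ≠ 0 := by
    refine ⟨-Real.log (-t₀), (Real.sqrt (-t₀))⁻¹ • x₀, ?_⟩
    rw [lerayOrbit_neg_log V ht₀ x₀]
    exact smul_ne_zero (Real.sqrt_pos.2 (neg_pos.2 ht₀)).ne' hx₀
  have hN14 := stub_headPressurePumping (lerayOrbit V) P (2 * Real.log c) C₀ hS hBL hper hpoly hprof hUne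
  -- N13: the floor is exceeded on some slice of the period
  have hfl : ∃ s ∈ Set.Icc (0 : ℝ) (2 * Real.log c),
      δ₀ < Real.sqrt (∫ y in Metric.ball (0 : EuclideanSpace ℝ (Fin 3)) R, ‖curl (lerayOrbit V s) y‖ ^ 2) := by
    by_contra h
    push Not at h
    have hz := hfloor c V p hc hcl hdecV hdssV h
    exact hx₀ (hz t₀ ht₀ x₀)
  -- N6 instance on every slice
  have hiso : ∀ t < 0, ∀ a b : EuclideanSpace ℝ (Fin 3),
      ∫ x, Real.exp (-‖x‖ ^ 2) * (⟪a, V t x⟫_ℝ * ⟪b, V t x⟫_ℝ) =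
        ⟪a, b⟫_ℝ / 3 * ∫ x, Real.exp (-‖x‖ ^ 2) * ‖V t x‖ ^ 2 := fun t ht a b =>
    portraitII_isotropy_gauss hirr (hV.continuous_slice ht) (fun x => hV.norm_le ht x)
      (fun g hg x => hequV g hg t x) a b
  exact ⟨V, C, p, P, hV, hdecV, hae, hdssV, hequV, hcl, hiso, hBL, hP0, hper, hprof, hN10, hN14, hfl⟩

end Summit.NavierStokesRegularity.NavierStokesRegularity.Theorems.PolyhedralDssProfileExists.PolyhedralCell

end
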